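import Summits.PneNP.PneNP.Theorems.ResolutionUncertainty.Negative.BruteForce
import Summits.PneNP.PneNP.Theorems.RamseyUncertifiableRamseyAbundant

/-!
# `ResolutionUncertainty` (stmt-PneNP-9816): the `∀ ε` strengthening is false; TRUE ⇒ `ε ≤ 2`

Calibration lemmas for the support item `Summit.PneNP.PneNP.Theses.RamseyUncertifiable.ResolutionUncertainty`,
ported from the cdisprove workfile `Cruxes/ResolutionUncertainty/Disproof.lean` (statements and proofs unchanged;
Ramsey graphs at the threshold now come from the landed `ramseyAbundant_proof`, item stmt-PneNP-9821).

* `AllExponents` — the item strengthened from SOME `ε > 0` to EVERY `ε` (`n^{ω(log n)}` hardness);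
  `not_allExponents : ¬ AllExponents` (registered stub): at `n = 2^m` a Ramsey graph (Erdős 1947) has both
  clique formulas refuted by brute force (`BruteForce.lean`) in `4(2m+1)(n+1)^{2m+1} < 2^{4m²} = n^{4 log₂ n}` lines.
* `hypotheses_satisfiable` — from `n = 3` on some `G` admits refutations of BOTH formulas: the item's
  `∀ π₁ π₂` is never vacuous.
* `ResolutionUncertaintyWith ε` — the item at a FIXED exponent (`resolutionUncertainty_iff_exists_with`,
  `Iff.rfl`); `eps_le_two_of_with : ResolutionUncertaintyWith ε → ε ≤ 2` and
  `not_resolutionUncertaintyWith_of_two_lt` (sharpened to `1/2` in `HalfBoundary.lean`).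
[Erdos1947; folklore]
-/

-- the mandated namespace `Summit.PneNP.PneNP.…` (summit = problem = `PneNP`) repeats `PneNP` by design
set_option linter.dupNamespace false

namespace Summit.PneNP.PneNP.Theorems.ResolutionUncertainty.Negative

open Literature.Computability.Complexity Literature.Computability.MetaComplexity
open Summit.PneNP.PneNP.Theses.RamseyUncertifiable
open Summit.PneNP.PneNP.Theorems.RegularResolutionRung.Negative (cliqueCNF)

/-! ### Numerics at `n = 2^m` -/

/-- At `n = 2^m` the crux's bound `n^{c log₂ n}` is `2^{c m²}`. -/
theorem rpow_logb_two_pow (m : ℕ) (c : ℝ) :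
    ((2 ^ m : ℕ) : ℝ) ^ (c * Real.logb 2 ((2 ^ m : ℕ) : ℝ)) = (2 : ℝ) ^ (c * m * m) := by
  have h2 : ((2 ^ m : ℕ) : ℝ) = (2 : ℝ) ^ (m : ℝ) := by
    rw [Nat.cast_pow, Nat.cast_ofNat, Real.rpow_natCast]
  rw [h2, Real.logb_rpow (by norm_num) (by norm_num), ← Real.rpow_mul (by norm_num)]
  congr 1
  ring

/-- At `n = 2^m` the threshold is `k(n) = 2m`. -/
theorem kR_two_pow (m : ℕ) : kR (2 ^ m) = 2 * m := by
  change Nat.clog 2 ((2 ^ m) ^ 2) = 2 * m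
  rw [← pow_mul, Nat.clog_pow _ _ one_lt_two]
  ring

/-- The crux strengthened from SOME exponent `ε > 0` to EVERY exponent (`n^{ω(log n)}`
hardness of certifying Ramsey-ness in resolution). -/
def AllExponents : Prop :=
  ∀ ε : ℝ, 0 < ε → ∃ n₀ : ℕ, ∀ n ≥ n₀, ∀ (G : SimpleGraph (Fin n)) [DecidableRel G.Adj],
    ∀ π₁ π₂ : List (ResLine ℕ),
      IsResRefutation (cliqueCNF n (kR n) fun u v => decide (G.Adj u v)) π₁ →
      IsResRefutation (cliqueCNF n (kR n) fun u v => decide (Gᶜ.Adj u v)) π₂ →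
      (n : ℝ) ^ (ε * Real.logb 2 n) ≤ max (π₁.length : ℝ) (π₂.length : ℝ)

/-- Pure arithmetic: `4 (2m+1) (2^m + 1)^{2m+1} < 2^{4m²}` for `m ≥ 3`. -/
theorem four_mul_pow_lt (m : ℕ) (hm : 3 ≤ m) :
    4 * ((2 * m + 1) * (2 ^ m + 1) ^ (2 * m + 1)) < 2 ^ (4 * m * m) := by
  have h0 : m < 2 ^ m := Nat.lt_two_pow_self
  have h1 : (2 ^ m + 1) ^ (2 * m + 1) ≤ (2 ^ (m + 1)) ^ (2 * m + 1) :=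
    Nat.pow_le_pow_left (by rw [pow_succ]; omega) _
  have h1' : 2 * m + 1 ≤ 2 ^ (m + 1) := by rw [pow_succ]; omega
  have h2 : 4 * (2 ^ (m + 1) * (2 ^ (m + 1)) ^ (2 * m + 1)) =
      2 ^ (2 + (m + 1) + (m + 1) * (2 * m + 1)) := by
    rw [← pow_mul, pow_add, pow_add]; ring
  have h3 : 2 + (m + 1) + (m + 1) * (2 * m + 1) < 4 * m * m := by nlinarith
  calc 4 * ((2 * m + 1) * (2 ^ m + 1) ^ (2 * m + 1))
      ≤ 4 * (2 ^ (m + 1) * (2 ^ (m + 1)) ^ (2 * m + 1)) :=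
        Nat.mul_le_mul_left 4 (Nat.mul_le_mul h1' h1)
    _ = 2 ^ (2 + (m + 1) + (m + 1) * (2 * m + 1)) := h2
    _ < 2 ^ (4 * m * m) := Nat.pow_lt_pow_right (by norm_num) h3

/-- **The all-exponents strengthening is false** (registered stub): Ramsey graphs exist at the threshold
(`ramseyAbundant_proof`, Erdős 1947), and at `n = 2^m` such a graph has both clique formulas refuted in
`4(2m+1)(n+1)^{2m+1} < 2^{4m²} = n^{4 log₂ n}` lines. -/
theorem not_allExponents : ¬ AllExponents := by
  intro h
  obtain ⟨n₀, hn⟩ := h 4 (by norm_num)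
  set m : ℕ := max n₀ 3 with hm
  have hm3 : 3 ≤ m := le_max_right _ _
  have hn₀ : n₀ ≤ 2 ^ m := (le_max_left _ _).trans (Nat.lt_two_pow_self : m < 2 ^ m).le
  have h3 : 3 ≤ 2 ^ m := hm3.trans (Nat.lt_two_pow_self : m < 2 ^ m).le
  obtain ⟨G, hG, hGc⟩ := Summit.PneNP.PneNP.Theorems.ramseyAbundant_proof (2 ^ m) h3
  classical
  obtain ⟨π₁, hπ₁, hl₁⟩ := exists_refutation_at_threshold G hG
  obtain ⟨π₂, hπ₂, hl₂⟩ := exists_refutation_at_threshold Gᶜ hGc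
  have hle := hn (2 ^ m) hn₀ G π₁ π₂ hπ₁ hπ₂
  rw [rpow_logb_two_pow] at hle
  rw [kR_two_pow] at hl₁ hl₂
  have hlt := four_mul_pow_lt m hm3
  have hcast : (2 : ℝ) ^ ((4 : ℝ) * m * m) = ((2 ^ (4 * m * m) : ℕ) : ℝ) := by
    rw [Nat.cast_pow, Nat.cast_ofNat, ← Real.rpow_natCast]
    congr 1
    push_cast
    ring
  rw [hcast] at hle
  have h1 : (π₁.length : ℝ) < ((2 ^ (4 * m * m) : ℕ) : ℝ) := by exact_mod_cast hl₁.trans_lt hlt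
  have h2 : (π₂.length : ℝ) < ((2 ^ (4 * m * m) : ℕ) : ℝ) := by exact_mod_cast hl₂.trans_lt hlt
  exact absurd hle (not_le.2 (max_lt h1 h2))

/-- **Non-vacuity.** From `n = 3` on, the item's hypotheses are satisfiable: some graph `G` on `Fin n` admits
resolution refutations of BOTH clique formulas at the threshold, so a proof must really bound lengths. -/
theorem hypotheses_satisfiable (n : ℕ) (hn : 3 ≤ n) :
    ∃ (G : SimpleGraph (Fin n)) (_ : DecidableRel G.Adj) (π₁ π₂ : List (ResLine ℕ)),
      IsResRefutation (cliqueCNF n (kR n) fun u v => decide (G.Adj u v)) π₁ ∧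
      IsResRefutation (cliqueCNF n (kR n) fun u v => decide (Gᶜ.Adj u v)) π₂ := by
  classical
  obtain ⟨G, hG, hGc⟩ := Summit.PneNP.PneNP.Theorems.ramseyAbundant_proof n hn
  obtain ⟨π₁, hπ₁, -⟩ := exists_refutation_at_threshold G hG
  obtain ⟨π₂, hπ₂, -⟩ := exists_refutation_at_threshold Gᶜ hGc
  exact ⟨G, inferInstance, π₁, π₂, hπ₁, hπ₂⟩

/-! ## The exponent is at most 2

`ResolutionUncertaintyWith ε` is the crux at a fixed exponent; the crux is `∃ ε > 0, … With ε`.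
Brute force shows no `ε > 2` can work. -/

/-- The crux at a FIXED exponent `ε`. -/
def ResolutionUncertaintyWith (ε : ℝ) : Prop :=
  ∃ n₀ : ℕ, ∀ n ≥ n₀, ∀ (G : SimpleGraph (Fin n)) [DecidableRel G.Adj],
    ∀ π₁ π₂ : List (ResLine ℕ),
      IsResRefutation (cliqueCNF n (kR n) fun u v => decide (G.Adj u v)) π₁ →
      IsResRefutation (cliqueCNF n (kR n) fun u v => decide (Gᶜ.Adj u v)) π₂ →
      (n : ℝ) ^ (ε * Real.logb 2 n) ≤ max (π₁.length : ℝ) (π₂.length : ℝ)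

/-- The item is `∃ ε > 0, ResolutionUncertaintyWith ε` (definitionally). -/
theorem resolutionUncertainty_iff_exists_with :
    ResolutionUncertainty ↔ ∃ ε : ℝ, 0 < ε ∧ ResolutionUncertaintyWith ε := Iff.rfl

/-- Real form of the brute-force count at `n = 2^m`: `4 (2m+1) (2^m+1)^{2m+1} ≤ 2^{2m² + 4m + 4}`. -/
theorem bruteForce_bound_real (m : ℕ) (hm : 1 ≤ m) :
    (4 * ((2 * m + 1) * (2 ^ m + 1) ^ (2 * m + 1)) : ℝ) ≤ (2 : ℝ) ^ ((2 * m * m + 4 * m + 4 : ℕ) : ℝ) := by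
  rw [Real.rpow_natCast]
  have h0 : m < 2 ^ m := Nat.lt_two_pow_self
  have h1 : (2 ^ m + 1) ^ (2 * m + 1) ≤ (2 ^ (m + 1)) ^ (2 * m + 1) :=
    Nat.pow_le_pow_left (by rw [pow_succ]; omega) _
  have h1' : 2 * m + 1 ≤ 2 ^ (m + 1) := by rw [pow_succ]; omega
  have h2 : 4 * (2 ^ (m + 1) * (2 ^ (m + 1)) ^ (2 * m + 1)) = 2 ^ (2 * m * m + 4 * m + 4) := by
    rw [← pow_mul, show 4 = 2 ^ 2 by norm_num, ← pow_add, ← pow_add]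
    congr 1; ring
  have h : 4 * ((2 * m + 1) * (2 ^ m + 1) ^ (2 * m + 1)) ≤ 2 ^ (2 * m * m + 4 * m + 4) := by
    calc 4 * ((2 * m + 1) * (2 ^ m + 1) ^ (2 * m + 1))
        ≤ 4 * (2 ^ (m + 1) * (2 ^ (m + 1)) ^ (2 * m + 1)) :=
          Nat.mul_le_mul_left 4 (Nat.mul_le_mul h1' h1)
      _ = 2 ^ (2 * m * m + 4 * m + 4) := h2
  exact_mod_cast h

/-- **Boundary lemma: the crux forces `ε ≤ 2`.** If `ResolutionUncertaintyWith ε` then `ε ≤ 2`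
(Ramsey graphs at `n = 2^m` have both clique formulas refuted by brute force in
`2^{2m² + O(m)} = n^{(2 + o(1)) log₂ n}` lines). The conjectured truth (LPRT, binary encoding) is
`ε = Ω(1)` small; random-like Ramsey graphs even give brute-force size `n^{(1/2 + o(1)) log₂ n}`. -/
theorem eps_le_two_of_with {ε : ℝ} (h : ResolutionUncertaintyWith ε) : ε ≤ 2 := by
  refine le_of_not_gt fun hε => ?_
  obtain ⟨n₀, hn⟩ := h
  -- choose `m` with `2^m ≥ n₀`, `m ≥ 3` and `(ε - 2) m ≥ 10`
  set m : ℕ := max (max n₀ 3) ⌈10 / (ε - 2)⌉₊ with hm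
  have hm3 : 3 ≤ m := (le_max_right _ _).trans (le_max_left _ _)
  have hn₀ : n₀ ≤ 2 ^ m := ((le_max_left _ _).trans (le_max_left _ _)).trans (Nat.lt_two_pow_self : m < 2 ^ m).le
  have hmε : 10 ≤ (ε - 2) * m := by
    have hpos : 0 < ε - 2 := by linarith
    have h1 : (10 / (ε - 2) : ℝ) ≤ m := (Nat.le_ceil _).trans (by exact_mod_cast le_max_right _ _)
    rw [div_le_iff₀ hpos] at h1
    linarith
  obtain ⟨G, hG, hGc⟩ := Summit.PneNP.PneNP.Theorems.ramseyAbundant_proof (2 ^ m) (hm3.trans (Nat.lt_two_pow_self : m < 2 ^ m).le)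
  classical
  obtain ⟨π₁, hπ₁, hl₁⟩ := exists_refutation_at_threshold G hG
  obtain ⟨π₂, hπ₂, hl₂⟩ := exists_refutation_at_threshold Gᶜ hGc
  have hle := hn (2 ^ m) hn₀ G π₁ π₂ hπ₁ hπ₂
  rw [rpow_logb_two_pow] at hle
  rw [kR_two_pow] at hl₁ hl₂
  have hB := bruteForce_bound_real m (by omega)
  have h1 : (π₁.length : ℝ) ≤ (2 : ℝ) ^ ((2 * m * m + 4 * m + 4 : ℕ) : ℝ) :=
    le_trans (by exact_mod_cast hl₁) hB
  have h2 : (π₂.length : ℝ) ≤ (2 : ℝ) ^ ((2 * m * m + 4 * m + 4 : ℕ) : ℝ) :=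
    le_trans (by exact_mod_cast hl₂) hB
  have hmax : max (π₁.length : ℝ) (π₂.length : ℝ) ≤ (2 : ℝ) ^ ((2 * m * m + 4 * m + 4 : ℕ) : ℝ) :=
    max_le h1 h2
  have hexp : ((2 * m * m + 4 * m + 4 : ℕ) : ℝ) < ε * m * m := by
    have hm3' : (3 : ℝ) ≤ m := by exact_mod_cast hm3
    push_cast
    nlinarith
  have hlt := Real.rpow_lt_rpow_of_exponent_lt (by norm_num : (1 : ℝ) < 2) hexp
  linarith

/-- In particular no exponent `ε > 2` works. -/
theorem not_resolutionUncertaintyWith_of_two_lt {ε : ℝ} (hε : 2 < ε) :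
    ¬ ResolutionUncertaintyWith ε := fun h => (not_le.2 hε) (eps_le_two_of_with h)

end Summit.PneNP.PneNP.Theorems.ResolutionUncertainty.Negative
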